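import Summits.AtomisticToContinuum.Crystallization.Theorems.FrustratedLawDichotomyStrainedPatchHomEntryLeafHTUCentredRot
import Summits.AtomisticToContinuum.Crystallization.Theorems.FrustratedLawDichotomyStrainedPatchHomEntryLeafHTCentredRotMustPass
import Summits.AtomisticToContinuum.Crystallization.Theorems.FrustratedLawDichotomyStrainedPatchHomEntryLeafHTMustPassD

/-!
# The fused one-fact certificate side at a cell of DIFFERENT WIDTH: the `0.8 t_b` must-pass cell at entry half-width `2⁻¹³`, MEASURED, and its end-to-end closure
# (27623 `(H) HomFloor (1/625)`, hcp half; hand-1 g32; critic rows 1226 (a) / 1228 (b) «one more leaf of different depth/width before the per-leaf constant moves»)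

decomp-a2c hand-1 g32 (crux `AperiodicFrustratedLawGap`, stmt-AtomisticToContinuum-27623).  Cell `cA × wA` of `…HomEntryLeafHTMustPassA` (`U⋆ + 0.8 t_b d₀`, entry
half-width `2⁻¹³` — HALF that of the crossover cells `cX90/cX95` —, shuffle `1.25·10⁻³`).  Certificate `pAU` = `pA` with `Gs` re-issued for the all-naive far
chunks (`581·10⁹`: near `≤ 566.5·10⁹` centred as in `…MustPassB.slope_near_A`, far naive `≤ 10.5·10⁹` / `≤ 3.1·10⁹` — the centred far bounds of record were
`8.7·10⁹` / `3.0·10⁹`; `D = DA`, `lam`, `γS`, `rS` unchanged).  Reduced universe at this cell: `1200` labels (near 350 / far₁ 357 / far₂ 402 / straddlers 2).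
KERNEL, MEASURED (hand-1 g32 seat `work/probe`):

* ★★ `htCertSideU_A` — the whole certificate side is ONE `decide +kernel` fact (timing in the hand-1 g32 FINDING memo; `≈ 100 s` class as at `cX90`/`cX95`);
* `treeOKUCR_A` — ONE inner leaf of `entryLeafOKHQDCR muRec qX90c` on the confined box; ★★ `entryLeafOKHT4UQDCR_A` — end to end.

Kernel definition (payload) + kernel facts + assembly; 0 sorry; standard axioms.  `--supports stmt-AtomisticToContinuum-27623`.
-/

namespace Summit.AtomisticToContinuum.Crystallization.Theorems.FrustratedLawDichotomyStrainedPatchHomEntryLeafHT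

open Literature.Analysis.ValidatedNumerics.Numerics
open Summit.AtomisticToContinuum.Crystallization.Theorems.FrustratedLawDichotomyStrainedPatchHomCertTree (CertTree treeOK)
open Summit.AtomisticToContinuum.Crystallization.Theorems.FrustratedLawDichotomyStrainedPatchHomEntryTable (muRec)
open Summit.AtomisticToContinuum.Crystallization.Theorems.FrustratedLawDichotomyStrainedPatchHomEntryFitHcpCentred (entryLeafOKHQDCR)

/-- The certificate of the `0.8 t_b` must-pass cell for the reduced-universe leaf: `pA` with `Gs` re-issued for the all-naive far chunks. -/
def pAU : HTCert where
  D := DA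
  lam₁ := 211106232532992
  lam₂ := -2814749767106
  lam₃ := -2814749767106
  Gs := 581000000000
  γS := pA.γS
  rS := pA.rS

set_option maxRecDepth 100000 in
set_option maxHeartbeats 4000000 in
/-- ★★ **KERNEL: THE FUSED CERTIFICATE SIDE OF THE `0.8 t_b` CELL (`U 2⁻¹³`) IS ONE FACT.** -/
theorem htCertSideU_A : htCertSideU pAU cA wA = true := by
  decide +kernel

set_option maxRecDepth 100000 in
set_option maxHeartbeats 4000000 in
/-- ★ KERNEL: ONE inner leaf of the centred rotated verdict (payload `qX90c`) closes the whole confined box of the `0.8 t_b` cell. -/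
theorem treeOKUCR_A : treeOK (entryLeafOKHQDCR muRec qX90c) CertTree.leaf cA (htWr pAU cA wA) = true := by
  decide +kernel

/-- ★★ **THE `0.8 t_b` CELL CLOSES END TO END THROUGH THE REDUCED-UNIVERSE LEAF.** [assembly] -/
theorem entryLeafOKHT4UQDCR_A : entryLeafOKHT4UQDCR muRec qX90c pAU CertTree.leaf cA wA = true := by
  have h1 := htCertSideU_A
  have h2 := treeOKUCR_A
  unfold entryLeafOKHT4UQDCR entryLeafOKHT4U
  rw [h1, h2]
  rfl

end Summit.AtomisticToContinuum.Crystallization.Theorems.FrustratedLawDichotomyStrainedPatchHomEntryLeafHT
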